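import Summits.BirchSwinnertonDyer.BirchSwinnertonDyer.Theorems.RamifiedHeegnerPairTwistUnitIntrinsic
import HarnessLib

/-!
# The twist-unit datum / U₁ / BSD₃ at intrinsic Gss2 rank-one curves — part D: `439794p1`, `205128l1`

Continuation of `…Theorems.RamifiedHeegnerPairTwistUnitIntrinsic` (seat `bsd-trib-w-rhp` g11; the doors `twistUnitFieldAt_of_sqrtField{_of_odd}`
and the honest framing are there): per curve `tu_at_<label> : … → SchneiderFree.Upper.TwistUnitFieldAt W 3`
(KERNEL field / Heegner hypothesis / twist identity / minimality; DISPLAYED `hN`, `hLt`, `hqd`/`hvd`), `u1_at_<label> : … → MissingUpperBoundAt W 3` by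
rhp-p2 g7 §3 `leafRankOneUpper_three_tamFree_of_print_of_twistUnit` (∏c_ℓ, ¬CM, Addv ∧ SubGss in the kernel; seven PRINTED facts + `hr`, `Dt`/`hc` displayed),
`bsd3_at_<label> : … → BSDp W 3` with g8's lower half. **Helper instances `--supports` U₁ (26022); nothing booked; no item closed; BSD is not proved
for any curve by this file.** [cite: MatarNekovar2019, Thm. 0.7 (p. 456)] [cite: GrossZagier1986, Thm. I.(6.3) and (7.3)] [cite: KrizLi2019, Thm. 1.20]
[cite: Silverman1994, IV.9.4] [cite: Cremona2006, Table 1]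
-/

set_option linter.dupNamespace false
set_option autoImplicit false

noncomputable section

open scoped Classical NumberField

open WeierstrassCurve NumberField IsDedekindDomain IsDedekindDomain.HeightOneSpectrum Rat.HeightOneSpectrum Field
  Literature Literature.NumberTheory.DiophantineGeometry Literature.NumberTheory.EllipticCurves
  Literature.NumberTheory.EllipticCurves.ModularForms Literature.NumberTheory.EllipticCurves.Rank1Residual
  Literature.NumberTheory.EllipticCurves.Rank1Residual.Typed Literature.NumberTheory.Automorphic
  Literature.NumberTheory.EllipticCurves.Rank1Residual.X11RankOneCertificates
  Literature.NumberTheory.EllipticCurves.KrizLi2019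
  Literature.NumberTheory.GaloisRepresentations Literature.NumberTheory.QuadraticFields
  Summit.BirchSwinnertonDyer.BirchSwinnertonDyer.Rank1Residual.IntModel
  Summit.BirchSwinnertonDyer.BirchSwinnertonDyer.Rank2Observatory.Tam
  Summit.BirchSwinnertonDyer.Rank1Residual Summit.BirchSwinnertonDyer.Rank1Residual.Additive
  Summit.BirchSwinnertonDyer.Rank1Residual.X11b Summit.BirchSwinnertonDyer.Rank1Residual.X11b.Three
  Summit.BirchSwinnertonDyer.Rank1Residual.GaloisImage Summit.BirchSwinnertonDyer.Rank1Residual.Supersingular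
  Summit.BirchSwinnertonDyer.BirchSwinnertonDyer.Theses.RamifiedHeegnerPair
  Summit.BirchSwinnertonDyer.BirchSwinnertonDyer.Theorems
  Summit.BirchSwinnertonDyer.BirchSwinnertonDyer.Theorems.SchneiderFree
  Summit.BirchSwinnertonDyer.BirchSwinnertonDyer.Theorems.RamifiedPairUpperBound
  Summit.BirchSwinnertonDyer.BirchSwinnertonDyer.Theorems.RamifiedHeegnerPairStepLIntrinsic
  Summit.BirchSwinnertonDyer.BirchSwinnertonDyer.Theorems.AdditiveBranchIMCGordTwoRankOne.HeegnerKolyvagin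

namespace Summit.BirchSwinnertonDyer.BirchSwinnertonDyer.Theorems.RamifiedHeegnerPairTwistUnitIntrinsic

/-! ## §9 `439794p1` = `[1, -1, 0, -412053, -101704843]`, `N = 439794 = 2·3^2·53·461`, `K = ℚ(√-95)`, `Wd = [1, -1, 0, -3718780017, 87288440474141]` (`N(Wd) = 3969140850`, `∏c(Wd) = 8`, `#Wd(ℚ)_tors = 1`, `#Ш(Wd)_an = 4`; `L(E^{(-95)},1) = 1.8275222549`) -/

/-- **THE TWIST-UNIT DATUM AT `439794p1` over `K = ℚ(√-95)`** — `SchneiderFree.Upper.TwistUnitFieldAt W 3` at `W = E`, member `W₂ = E`. KERNEL: the field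
(`sqrtField (-95)`, imaginary quadratic, `d_K = -95` odd), the Heegner hypothesis at `N = 439794` (`-95 ≡ 1 (mod 8)`, `(-95/ℓ) = 1` at the odd `ℓ ∣ N`),
Kraus minimality of `Wd` (`isGloballyMinimal_gWd439794p1`, by name), the twist identity `Cd • E^{(-95)} = Wd` with `Cd = [1, -24), 1/2), 0]`. DISPLAYED: Cremona's
`N(E) = 439794` (`hN`), `L(E^{(-95)},1) = 1.8275222549 ≠ 0` (`hLt`, PARI `ellL1` = `lfun`), `#Ш(Wd)_an = 4` (`hqd`/`hvd`; g9 kit j304074, g11 TU census).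
A per-curve certificate of the research statement TU₁; nothing booked; BSD is not proved by this. [cite: KrizLi2019, Thm. 1.20]
[cite: GrossZagier1986, Thm. I.(6.3)] [cite: Cremona2006, Table 1 (Cremona label 439794p1)] -/
theorem tu_at_439794p1 {W : WeierstrassCurve ℚ} [W.IsElliptic] [W.IsGloballyMinimal] (hWeq : W = (⟨1, -1, 0, -412053, -101704843⟩ : WeierstrassCurve ℚ))
    (hN : W.conductorNorm ℤ = 439794) (hLt : (W.quadraticTwist ((-95 : ℤ) : ℚ)).entireLFunction 1 ≠ 0)
    {qd : ℚ} (hqd : haveI := isElliptic_gWd439794p1; shaAn (⟨1, -1, 0, -3718780017, 87288440474141⟩ : WeierstrassCurve ℚ) = (qd : ℂ)) (hvd : padicValRat 3 qd ≤ 0) :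
    Upper.TwistUnitFieldAt W 3 := by
  subst hWeq
  haveI := isElliptic_gWd439794p1; haveI := isGloballyMinimal_gWd439794p1
  haveI : Fact ((-95 : ℤ) < 0) := ⟨by norm_num⟩
  have hjac : ∀ ℓ : ℕ, ℓ.Prime → ℓ ∣ 439794 → ℓ ≠ 2 → jacobiSym (-95) ℓ = 1 := by
    intro ℓ hℓ hℓN hℓ2
    have hmem : ℓ ∈ Nat.primeFactors 439794 := Nat.mem_primeFactors.mpr ⟨hℓ, hℓN, by norm_num⟩
    have hpf : Nat.primeFactors 439794 = {2, 3, 53, 461} := by decide +kernel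
    rw [hpf] at hmem
    simp only [Finset.mem_insert, Finset.mem_singleton] at hmem
    rcases hmem with rfl | rfl | rfl | rfl
    · exact absurd rfl hℓ2
    all_goals norm_num
  have hWd : (⟨1, ((-24 : ℚ)), ((1 : ℚ)/2), (0 : ℚ)⟩ : VariableChange ℚ) •
      (⟨1, -1, 0, -412053, -101704843⟩ : WeierstrassCurve ℚ).quadraticTwist ((-95 : ℤ) : ℚ) = (⟨1, -1, 0, -3718780017, 87288440474141⟩ : WeierstrassCurve ℚ) := by
    push_cast
    ext <;> simp [WeierstrassCurve.variableChange_a₁, WeierstrassCurve.variableChange_a₂,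
      WeierstrassCurve.variableChange_a₃, WeierstrassCurve.variableChange_a₄, WeierstrassCurve.variableChange_a₆,
      WeierstrassCurve.quadraticTwist, WeierstrassCurve.b₂, WeierstrassCurve.b₄, WeierstrassCurve.b₆] <;> norm_num
  exact twistUnitFieldAt_of_sqrtField _ 3 439794 (-95) (by norm_num)
    (by rw [show (-95 : ℤ).natAbs = 95 by rfl, Nat.squarefree_iff_nodup_primeFactorsList (by norm_num)]; simp)
    hjac hN hLt _ _ hWd hqd hvd

/-- **U₁ AT `439794p1` BY THE TWIST-UNIT ROAD** — `MissingUpperBoundAt W 3` (`ord₃ #Ш(E) ≤ ord₃ #Ш(E)_an`) at `W = E` from rhp-p2 g7 §3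
`leafRankOneUpper_three_tamFree_of_print_of_twistUnit`: PRINTED binders `hGZ hKo hGZK hmod hGZ73 hMN hCassels` (Gross–Zagier ∀, Kolyvagin ∀, GZK,
Version L, GZ I.(7.3), Matar–Nekovář 2019 Thm 0.7 irreducible form, Cassels); KERNEL: `∏ c_ℓ(E) = 4` (k1 `tamagawaProduct_g439794p1` by name), `¬ CM` (`j = c₄³/Δ` is none of the
thirteen CM `j`-invariants, `hasCM_iff_j_mem_holds` + `norm_num`), `Addv ∧ SubGss` at `3` (`subGss_g439794p1_3`), and everything kernel in `tu_at_439794p1`; DISPLAYED: `hN`, `hr` (`r_an(E) = 1`, Cremona),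
the parametrisation datum `Dt` at level `N_E` with `3 ∤ c(Dt)` (`hc`; Manin constant `1` for this optimal curve, Cremona `manin.txt`), `hLt`, `hqd`/`hvd`.
NO S2, NO Σ, NO L₀, NO image hypothesis. Per curve; U₁ (26022) stays OPEN; BSD is not proved by this.
[cite: MatarNekovar2019, Thm. 0.7 (p. 456) and §0.11 (p. 457)] [cite: GrossZagier1986, Thm. I.(6.3) and (7.3)] [cite: Miller2011LMS, Def. 1.1]
[cite: Cremona2006, Table 1 (Cremona label 439794p1)] -/
theorem u1_at_439794p1
    (hGZ : ∀ (N : ℕ) [NeZero N] (W : WeierstrassCurve ℚ) (K : Type) [Field K] [NumberField K], gross_zagier N W K)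
    (hKo : ∀ (N : ℕ) [NeZero N] (W : WeierstrassCurve ℚ) (K : Type) [Field K] [NumberField K], kolyvagin N W K)
    (hGZK : rank_eq_analyticRank_of_analyticRank_le_one) (hmod : hasEntireLFunction_rat)
    (hGZ73 : GrossZagier1986_thm_I_7_3)
    (hMN : MatarNekovar2019.thm07_padicValNat_card_sha_primary_add_le_of_globalDivisibility_of_irreducible)
    (hCassels : bsdRHS_eq_of_isIsogenous)
    {W : WeierstrassCurve ℚ} [W.IsElliptic] [W.IsGloballyMinimal] (hWeq : W = (⟨1, -1, 0, -412053, -101704843⟩ : WeierstrassCurve ℚ))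
    (hN : W.conductorNorm ℤ = 439794) [NeZero (W.conductorNorm ℤ)] (hr : W.analyticRank = 1)
    (Dt : ModularParametrizationData W (W.conductorNorm ℤ)) (hc : ¬ (3 : ℤ) ∣ Dt.c)
    (hLt : (W.quadraticTwist ((-95 : ℤ) : ℚ)).entireLFunction 1 ≠ 0)
    {qd : ℚ} (hqd : haveI := isElliptic_gWd439794p1; shaAn (⟨1, -1, 0, -3718780017, 87288440474141⟩ : WeierstrassCurve ℚ) = (qd : ℂ)) (hvd : padicValRat 3 qd ≤ 0) :
    MissingUpperBoundAt W 3 := by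
  have hTU : Upper.TwistUnitFieldAt W 3 := tu_at_439794p1 hWeq hN hLt hqd hvd
  subst hWeq
  have hI : integralModelInt (⟨1, -1, 0, -412053, -101704843⟩ : WeierstrassCurve ℚ) = (⟨1, -1, 0, -412053, -101704843⟩ : WeierstrassCurve ℤ) :=
    integralModelInt_eq_of_map_eq _ (map_mk_int 1 (-1) 0 (-412053) (-101704843))
  have htam : ¬ 3 ∣ (⟨1, -1, 0, -412053, -101704843⟩ : WeierstrassCurve ℚ).tamagawaProduct := by rw [tamagawaProduct_g439794p1 hI]; norm_num
  have hCM : ¬ (⟨1, -1, 0, -412053, -101704843⟩ : WeierstrassCurve ℚ).HasCM := fun hCM ↦ by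
    have hj := (WeierstrassCurve.hasCM_iff_j_mem_holds (⟨1, -1, 0, -412053, -101704843⟩ : WeierstrassCurve ℚ)).1 hCM
    rw [WeierstrassCurve.j, Units.val_inv_eq_inv_val, WeierstrassCurve.coe_Δ'] at hj
    simp only [cmJInvariants, Finset.mem_insert, Finset.mem_singleton] at hj
    norm_num [WeierstrassCurve.Δ, WeierstrassCurve.b₂, WeierstrassCurve.b₄, WeierstrassCurve.b₆, WeierstrassCurve.b₈,
      WeierstrassCurve.c₄] at hj
  exact leafRankOneUpper_three_tamFree_of_print_of_twistUnit hGZ hKo hGZK hmod hGZ73 hMN hCassels _ hCM subGss_g439794p1_3.1 subGss_g439794p1_3.2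
    hr htam Dt hc hTU

/-- **BSD₃ AT `439794p1` modulo print and displayed numerics, by the twist-unit road** — `BSDp W 3` from `u1_at_439794p1` (upper half) and g8's LOWER half
`RamifiedHeegnerPairL1Intrinsic.lowerHalf_three_439794p1` (`9 ∣ #Ш(E)` by the rigorous 3-descent certificate `27 ∣ #Sel₃(E)`, displayed as `hSel`, with
`#Ш(E)_an = q`, `ord₃ q ≤ 2` displayed), glued by `Typed.missingPPartAt_of_lower_of_upper` + `Typed.bsdp_of_missingPPartAt` (GZK). Per curve, CONDITIONAL on
every displayed input and the seven printed facts; nothing booked; BSD is not proved by this. [cite: Miller2011LMS, Def. 1.1] [cite: SchaeferStoll2004, Cor. 5.9]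
[cite: MatarNekovar2019, Thm. 0.7 (p. 456)] [cite: Cremona2006, Table 1 (Cremona label 439794p1)] -/
theorem bsd3_at_439794p1
    (hGZ : ∀ (N : ℕ) [NeZero N] (W : WeierstrassCurve ℚ) (K : Type) [Field K] [NumberField K], gross_zagier N W K)
    (hKo : ∀ (N : ℕ) [NeZero N] (W : WeierstrassCurve ℚ) (K : Type) [Field K] [NumberField K], kolyvagin N W K)
    (hGZK : rank_eq_analyticRank_of_analyticRank_le_one) (hmod : hasEntireLFunction_rat)
    (hGZ73 : GrossZagier1986_thm_I_7_3)
    (hMN : MatarNekovar2019.thm07_padicValNat_card_sha_primary_add_le_of_globalDivisibility_of_irreducible)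
    (hCassels : bsdRHS_eq_of_isIsogenous)
    {W : WeierstrassCurve ℚ} [W.IsElliptic] [W.IsGloballyMinimal] (hWeq : W = (⟨1, -1, 0, -412053, -101704843⟩ : WeierstrassCurve ℚ))
    (hN : W.conductorNorm ℤ = 439794) [NeZero (W.conductorNorm ℤ)] (hr : W.analyticRank = 1)
    {q : ℚ} (hq : shaAn W = (q : ℂ)) (hv : padicValRat 3 q ≤ 2) (hSel : 3 ^ 3 ∣ Nat.card (W.selmerGroup 3))
    (Dt : ModularParametrizationData W (W.conductorNorm ℤ)) (hc : ¬ (3 : ℤ) ∣ Dt.c)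
    (hLt : (W.quadraticTwist ((-95 : ℤ) : ℚ)).entireLFunction 1 ≠ 0)
    {qd : ℚ} (hqd : haveI := isElliptic_gWd439794p1; shaAn (⟨1, -1, 0, -3718780017, 87288440474141⟩ : WeierstrassCurve ℚ) = (qd : ℂ)) (hvd : padicValRat 3 qd ≤ 0) :
    BSDp W 3 := by
  have hup : MissingUpperBoundAt W 3 := u1_at_439794p1 hGZ hKo hGZK hmod hGZ73 hMN hCassels hWeq hN hr Dt hc hLt hqd hvd
  subst hWeq
  have hlow : MissingLowerBoundAt (⟨1, -1, 0, -412053, -101704843⟩ : WeierstrassCurve ℚ) 3 :=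
    RamifiedHeegnerPairL1Intrinsic.lowerHalf_three_439794p1 hGZK hr hq hv hSel
  exact Typed.bsdp_of_missingPPartAt _ 3 hGZK hr.le (Typed.missingPPartAt_of_lower_of_upper _ 3 hlow hup)

/-! ## §10 `205128l1` = `[0, 0, 0, -140542659, -679555229778]`, `N = 205128 = 2^3·3^2·7·11·37`, `K = ℚ(√-887)`, `Wd = [0, 0, 0, -110574607278771, 474237200867982859134]` (`N(Wd) = 161388351432`, `∏c(Wd) = 32`, `#Wd(ℚ)_tors = 2`, `#Ш(Wd)_an = 100`; `L(E^{(-887)},1) = 1.7926016266`) -/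

/-- **THE TWIST-UNIT DATUM AT `205128l1` over `K = ℚ(√-887)`** — `SchneiderFree.Upper.TwistUnitFieldAt W 3` at `W = E`, member `W₂ = E`. KERNEL: the field
(`sqrtField (-887)`, imaginary quadratic, `d_K = -887` odd), the Heegner hypothesis at `N = 205128` (`-887 ≡ 1 (mod 8)`, `(-887/ℓ) = 1` at the odd `ℓ ∣ N`),
Kraus minimality of `Wd` (`isGloballyMinimal_gWd205128l1`, by name), the twist identity `Cd • E^{(-887)} = Wd` with `Cd = [1, 0, 0, 0]`. DISPLAYED: Cremona's
`N(E) = 205128` (`hN`), `L(E^{(-887)},1) = 1.7926016266 ≠ 0` (`hLt`, PARI `ellL1` = `lfun`), `#Ш(Wd)_an = 100` (`hqd`/`hvd`; g9 kit j304074, g11 TU census).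
A per-curve certificate of the research statement TU₁; nothing booked; BSD is not proved by this. [cite: KrizLi2019, Thm. 1.20]
[cite: GrossZagier1986, Thm. I.(6.3)] [cite: Cremona2006, Table 1 (Cremona label 205128l1)] -/
theorem tu_at_205128l1 {W : WeierstrassCurve ℚ} [W.IsElliptic] [W.IsGloballyMinimal] (hWeq : W = (⟨0, 0, 0, -140542659, -679555229778⟩ : WeierstrassCurve ℚ))
    (hN : W.conductorNorm ℤ = 205128) (hLt : (W.quadraticTwist ((-887 : ℤ) : ℚ)).entireLFunction 1 ≠ 0)
    {qd : ℚ} (hqd : haveI := isElliptic_gWd205128l1; shaAn (⟨0, 0, 0, -110574607278771, 474237200867982859134⟩ : WeierstrassCurve ℚ) = (qd : ℂ)) (hvd : padicValRat 3 qd ≤ 0) :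
    Upper.TwistUnitFieldAt W 3 := by
  subst hWeq
  haveI := isElliptic_gWd205128l1; haveI := isGloballyMinimal_gWd205128l1
  haveI : Fact ((-887 : ℤ) < 0) := ⟨by norm_num⟩
  have hjac : ∀ ℓ : ℕ, ℓ.Prime → ℓ ∣ 205128 → ℓ ≠ 2 → jacobiSym (-887) ℓ = 1 := by
    intro ℓ hℓ hℓN hℓ2
    have hmem : ℓ ∈ Nat.primeFactors 205128 := Nat.mem_primeFactors.mpr ⟨hℓ, hℓN, by norm_num⟩
    have hpf : Nat.primeFactors 205128 = {2, 3, 7, 11, 37} := by decide +kernel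
    rw [hpf] at hmem
    simp only [Finset.mem_insert, Finset.mem_singleton] at hmem
    rcases hmem with rfl | rfl | rfl | rfl | rfl
    · exact absurd rfl hℓ2
    all_goals norm_num
  have hWd : (⟨1, (0 : ℚ), (0 : ℚ), (0 : ℚ)⟩ : VariableChange ℚ) •
      (⟨0, 0, 0, -140542659, -679555229778⟩ : WeierstrassCurve ℚ).quadraticTwist ((-887 : ℤ) : ℚ) = (⟨0, 0, 0, -110574607278771, 474237200867982859134⟩ : WeierstrassCurve ℚ) := by
    push_cast
    ext <;> simp [WeierstrassCurve.variableChange_a₁, WeierstrassCurve.variableChange_a₂,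
      WeierstrassCurve.variableChange_a₃, WeierstrassCurve.variableChange_a₄, WeierstrassCurve.variableChange_a₆,
      WeierstrassCurve.quadraticTwist, WeierstrassCurve.b₂, WeierstrassCurve.b₄, WeierstrassCurve.b₆] <;> norm_num
  exact twistUnitFieldAt_of_sqrtField _ 3 205128 (-887) (by norm_num)
    (by rw [show (-887 : ℤ).natAbs = 887 by rfl, Nat.squarefree_iff_nodup_primeFactorsList (by norm_num)]; simp)
    hjac hN hLt _ _ hWd hqd hvd

/-- **U₁ AT `205128l1` BY THE TWIST-UNIT ROAD** — `MissingUpperBoundAt W 3` (`ord₃ #Ш(E) ≤ ord₃ #Ш(E)_an`) at `W = E` from rhp-p2 g7 §3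
`leafRankOneUpper_three_tamFree_of_print_of_twistUnit`: PRINTED binders `hGZ hKo hGZK hmod hGZ73 hMN hCassels` (Gross–Zagier ∀, Kolyvagin ∀, GZK,
Version L, GZ I.(7.3), Matar–Nekovář 2019 Thm 0.7 irreducible form, Cassels); KERNEL: `∏ c_ℓ(E) = 16` (k1 `tamagawaProduct_g205128l1` by name), `¬ CM` (`j = c₄³/Δ` is none of the
thirteen CM `j`-invariants, `hasCM_iff_j_mem_holds` + `norm_num`), `Addv ∧ SubGss` at `3` (`subGss_g205128l1_3`), and everything kernel in `tu_at_205128l1`; DISPLAYED: `hN`, `hr` (`r_an(E) = 1`, Cremona),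
the parametrisation datum `Dt` at level `N_E` with `3 ∤ c(Dt)` (`hc`; Manin constant `1` for this optimal curve, Cremona `manin.txt`), `hLt`, `hqd`/`hvd`.
NO S2, NO Σ, NO L₀, NO image hypothesis. Per curve; U₁ (26022) stays OPEN; BSD is not proved by this.
[cite: MatarNekovar2019, Thm. 0.7 (p. 456) and §0.11 (p. 457)] [cite: GrossZagier1986, Thm. I.(6.3) and (7.3)] [cite: Miller2011LMS, Def. 1.1]
[cite: Cremona2006, Table 1 (Cremona label 205128l1)] -/
theorem u1_at_205128l1
    (hGZ : ∀ (N : ℕ) [NeZero N] (W : WeierstrassCurve ℚ) (K : Type) [Field K] [NumberField K], gross_zagier N W K)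
    (hKo : ∀ (N : ℕ) [NeZero N] (W : WeierstrassCurve ℚ) (K : Type) [Field K] [NumberField K], kolyvagin N W K)
    (hGZK : rank_eq_analyticRank_of_analyticRank_le_one) (hmod : hasEntireLFunction_rat)
    (hGZ73 : GrossZagier1986_thm_I_7_3)
    (hMN : MatarNekovar2019.thm07_padicValNat_card_sha_primary_add_le_of_globalDivisibility_of_irreducible)
    (hCassels : bsdRHS_eq_of_isIsogenous)
    {W : WeierstrassCurve ℚ} [W.IsElliptic] [W.IsGloballyMinimal] (hWeq : W = (⟨0, 0, 0, -140542659, -679555229778⟩ : WeierstrassCurve ℚ))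
    (hN : W.conductorNorm ℤ = 205128) [NeZero (W.conductorNorm ℤ)] (hr : W.analyticRank = 1)
    (Dt : ModularParametrizationData W (W.conductorNorm ℤ)) (hc : ¬ (3 : ℤ) ∣ Dt.c)
    (hLt : (W.quadraticTwist ((-887 : ℤ) : ℚ)).entireLFunction 1 ≠ 0)
    {qd : ℚ} (hqd : haveI := isElliptic_gWd205128l1; shaAn (⟨0, 0, 0, -110574607278771, 474237200867982859134⟩ : WeierstrassCurve ℚ) = (qd : ℂ)) (hvd : padicValRat 3 qd ≤ 0) :
    MissingUpperBoundAt W 3 := by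
  have hTU : Upper.TwistUnitFieldAt W 3 := tu_at_205128l1 hWeq hN hLt hqd hvd
  subst hWeq
  have hI : integralModelInt (⟨0, 0, 0, -140542659, -679555229778⟩ : WeierstrassCurve ℚ) = (⟨0, 0, 0, -140542659, -679555229778⟩ : WeierstrassCurve ℤ) :=
    integralModelInt_eq_of_map_eq _ (map_mk_int 0 0 0 (-140542659) (-679555229778))
  have htam : ¬ 3 ∣ (⟨0, 0, 0, -140542659, -679555229778⟩ : WeierstrassCurve ℚ).tamagawaProduct := by rw [tamagawaProduct_g205128l1 hI]; norm_num
  have hCM : ¬ (⟨0, 0, 0, -140542659, -679555229778⟩ : WeierstrassCurve ℚ).HasCM := fun hCM ↦ by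
    have hj := (WeierstrassCurve.hasCM_iff_j_mem_holds (⟨0, 0, 0, -140542659, -679555229778⟩ : WeierstrassCurve ℚ)).1 hCM
    rw [WeierstrassCurve.j, Units.val_inv_eq_inv_val, WeierstrassCurve.coe_Δ'] at hj
    simp only [cmJInvariants, Finset.mem_insert, Finset.mem_singleton] at hj
    norm_num [WeierstrassCurve.Δ, WeierstrassCurve.b₂, WeierstrassCurve.b₄, WeierstrassCurve.b₆, WeierstrassCurve.b₈,
      WeierstrassCurve.c₄] at hj
  exact leafRankOneUpper_three_tamFree_of_print_of_twistUnit hGZ hKo hGZK hmod hGZ73 hMN hCassels _ hCM subGss_g205128l1_3.1 subGss_g205128l1_3.2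
    hr htam Dt hc hTU

/-- **BSD₃ AT `205128l1` modulo print and displayed numerics, by the twist-unit road** — `BSDp W 3` from `u1_at_205128l1` (upper half) and g8's LOWER half
`RamifiedHeegnerPairL1Intrinsic.lowerHalf_three_205128l1` (`9 ∣ #Ш(E)` by the rigorous 3-descent certificate `27 ∣ #Sel₃(E)`, displayed as `hSel`, with
`#Ш(E)_an = q`, `ord₃ q ≤ 2` displayed), glued by `Typed.missingPPartAt_of_lower_of_upper` + `Typed.bsdp_of_missingPPartAt` (GZK). Per curve, CONDITIONAL on
every displayed input and the seven printed facts; nothing booked; BSD is not proved by this. [cite: Miller2011LMS, Def. 1.1] [cite: SchaeferStoll2004, Cor. 5.9]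
[cite: MatarNekovar2019, Thm. 0.7 (p. 456)] [cite: Cremona2006, Table 1 (Cremona label 205128l1)] -/
theorem bsd3_at_205128l1
    (hGZ : ∀ (N : ℕ) [NeZero N] (W : WeierstrassCurve ℚ) (K : Type) [Field K] [NumberField K], gross_zagier N W K)
    (hKo : ∀ (N : ℕ) [NeZero N] (W : WeierstrassCurve ℚ) (K : Type) [Field K] [NumberField K], kolyvagin N W K)
    (hGZK : rank_eq_analyticRank_of_analyticRank_le_one) (hmod : hasEntireLFunction_rat)
    (hGZ73 : GrossZagier1986_thm_I_7_3)
    (hMN : MatarNekovar2019.thm07_padicValNat_card_sha_primary_add_le_of_globalDivisibility_of_irreducible)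
    (hCassels : bsdRHS_eq_of_isIsogenous)
    {W : WeierstrassCurve ℚ} [W.IsElliptic] [W.IsGloballyMinimal] (hWeq : W = (⟨0, 0, 0, -140542659, -679555229778⟩ : WeierstrassCurve ℚ))
    (hN : W.conductorNorm ℤ = 205128) [NeZero (W.conductorNorm ℤ)] (hr : W.analyticRank = 1)
    {q : ℚ} (hq : shaAn W = (q : ℂ)) (hv : padicValRat 3 q ≤ 2) (hSel : 3 ^ 3 ∣ Nat.card (W.selmerGroup 3))
    (Dt : ModularParametrizationData W (W.conductorNorm ℤ)) (hc : ¬ (3 : ℤ) ∣ Dt.c)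
    (hLt : (W.quadraticTwist ((-887 : ℤ) : ℚ)).entireLFunction 1 ≠ 0)
    {qd : ℚ} (hqd : haveI := isElliptic_gWd205128l1; shaAn (⟨0, 0, 0, -110574607278771, 474237200867982859134⟩ : WeierstrassCurve ℚ) = (qd : ℂ)) (hvd : padicValRat 3 qd ≤ 0) :
    BSDp W 3 := by
  have hup : MissingUpperBoundAt W 3 := u1_at_205128l1 hGZ hKo hGZK hmod hGZ73 hMN hCassels hWeq hN hr Dt hc hLt hqd hvd
  subst hWeq
  have hlow : MissingLowerBoundAt (⟨0, 0, 0, -140542659, -679555229778⟩ : WeierstrassCurve ℚ) 3 :=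
    RamifiedHeegnerPairL1Intrinsic.lowerHalf_three_205128l1 hGZK hr hq hv hSel
  exact Typed.bsdp_of_missingPPartAt _ 3 hGZK hr.le (Typed.missingPPartAt_of_lower_of_upper _ 3 hlow hup)

end Summit.BirchSwinnertonDyer.BirchSwinnertonDyer.Theorems.RamifiedHeegnerPairTwistUnitIntrinsic

end
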